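import Summits.HodgeConjecture.CorCM.Census.DecicWeil23PairTwoTransitive
import Mathlib.Data.Fintype.Perm
import HarnessLib

/-!
# TWO `(2,3)`-types over one DECIC CM field with DIHEDRAL quintic part: the DEFECT LAW from the ten permutations of a
# dihedral group `D₅` of the five conjugate pairs (kernel census: the six dihedral subgroups of `A₅`, both normal positions)

COR-CM (cell `pub-hodgecm2`), seat b30 gen 23 (2026-08-22); count-neutral own lane DECIC-2T, part 3 «DECIC-D5».  Bookkeeping
definitions and theorems of the finite model `Census/DecicWeil23Pair`; no named fact, no geometry, no `sorry`.

WHY.  The `2`-transitive theory (`Census/DecicWeil23PairTwoTransitive`) covers the quintic parts `S₅`, `A₅`, `F₂₀`; seat b09's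
`DecicCurveFivefold*` the CYCLIC part `C₅` (one fivefold).  The remaining transitive subgroup of `S₅` is the DIHEDRAL group `D₅`
(order `10`, totally real quintics `K⁺` with dihedral Galois closure), not `2`-transitive.  Every NON-cyclic transitive subgroup
of `S₅` (`D₅`, `F₂₀`, `A₅`, `S₅`) contains one of the SIX dihedral subgroups `D₅(j) ⊂ A₅` (`j < 6`, the normalisers in `A₅` of the
six Sylow `5`-subgroups), tabulated here as `dihTab j` (rows `0–4`: the rotations `ρ_j^t`, rows `5–9`: the five reflections).
EXACT CENSUS (python, seat folder `work/d5/d5census.py`): with the two types at the normal positions of `Census/DecicWeil23Pair`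
(`I_0 = {0,1}`; `I_1 = {1,2}` if `c`, `{3,2}` if `¬c`) the ten signed equations of `D₅(j)` have nullity `2` (the defect law) for
ALL six `j` when the types MEET (`c = true`) and for `j ∉ {1, 2}` when they are DISJOINT (`c = false`; for `j = 1, 2` — the
«mirror» positions, where the reflection of `D₅(j)` fixing `I_0` also fixes `I_1` — the nullity is `6`: genuinely new classes);
`dihGood c j` records the ten clean cases.  (One type is clean under `C₅` already; three types are never clean under `D₅`,
nullity `7`.)

RESULTS (kernel).  `dihTab`, `dihPerm`, `dihedralPerms j` (as a finset of `Sym(5)`), `dihPerm_eq_word` (every element is a word in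
any nontrivial rotation power and any reflection), `exists_dihedral_conj` (for EVERY `g ∈ Sym(5)`, `g ρ₀ g⁻¹` and `g r₀ g⁻¹`
are a rotation power and a reflection of some `D₅(j)` — so a realised rotation/reflection pair in any labelling lands in the
table);
**`defectD_of_signed_dihedral`** — for the ten clean `(c, j)` the equations at the ten rows force `d_{m,a} = d_{m,0}`,
`e = d_{0,0} + d_{1,0}` (ten small linear solves, `linarith`); **`modelBalancedD_of_modelBalancedP_dihedral`** — a configuration
balanced under `dihedralPerms j` (`ModelBalancedP` of `Census/DecicWeil23PairTwoTransitive`) satisfies all sixty `A₅` equations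
`ModelBalancedD` (via `signed_of_defectD`), so gen 22's chain applies BY NAME.
[cite: DixonMortimer1996, §2.1] [cite: MoonenZarhin1995Duke, Thm. 2.4] [cite: GaoUllmo2025, Thm 3.1] [cite: Pohlmann1968, Thm 1]

## References
* [DixonMortimer1996] J. D. Dixon, B. Mortimer, *Permutation Groups*, GTM 163 (1996), §2.1.  [MoonenZarhin1995Duke] B. Moonen,
  Yu. Zarhin, Duke Math. J. 77 (1995), Thm. 2.4.  [GaoUllmo2025] Z. Gao, E. Ullmo, J. Inst. Math. Jussieu 25 (2025), Thm 3.1.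
  [Pohlmann1968] H. Pohlmann, Ann. of Math. 88 (1968), Thm 1.
-/

namespace Summit.HodgeConjecture.CorCM.Census.DecicWeil23Pair

open Finset

/-! ## §1 The six dihedral subgroups of `A₅` -/

/-- **The six dihedral groups `D₅(j) ⊂ A₅`** (normalisers in `A₅` of the six Sylow `5`-subgroups), as a table of maps of the
five pairs: rows `0–4` the rotations `ρ_j^t` (`ρ_j` = row `1`), rows `5–9` the five reflections. [folklore] -/
def dihTab : Fin 6 → Fin 10 → Fin 5 → Fin 5 :=
  ![![![0, 1, 2, 3, 4], ![1, 2, 3, 4, 0], ![2, 3, 4, 0, 1], ![3, 4, 0, 1, 2], ![4, 0, 1, 2, 3], ![0, 4, 3, 2, 1], ![1, 0, 4, 3, 2], ![2, 1, 0, 4, 3], ![3, 2, 1, 0, 4], ![4, 3, 2, 1, 0]],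
    ![![0, 1, 2, 3, 4], ![1, 2, 4, 0, 3], ![2, 4, 3, 1, 0], ![4, 3, 0, 2, 1], ![3, 0, 1, 4, 2], ![0, 3, 4, 1, 2], ![1, 0, 3, 2, 4], ![2, 1, 0, 4, 3], ![3, 4, 2, 0, 1], ![4, 2, 1, 3, 0]],
    ![![0, 1, 2, 3, 4], ![1, 3, 0, 4, 2], ![3, 4, 1, 2, 0], ![4, 2, 3, 0, 1], ![2, 0, 4, 1, 3], ![0, 2, 1, 4, 3], ![1, 0, 3, 2, 4], ![2, 4, 0, 3, 1], ![3, 1, 4, 0, 2], ![4, 3, 2, 1, 0]],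
    ![![0, 1, 2, 3, 4], ![1, 3, 4, 2, 0], ![3, 2, 0, 4, 1], ![2, 4, 1, 0, 3], ![4, 0, 3, 1, 2], ![0, 4, 3, 2, 1], ![1, 0, 2, 4, 3], ![2, 3, 0, 1, 4], ![3, 1, 4, 0, 2], ![4, 2, 1, 3, 0]],
    ![![0, 1, 2, 3, 4], ![1, 4, 0, 2, 3], ![4, 3, 1, 0, 2], ![3, 2, 4, 1, 0], ![2, 0, 3, 4, 1], ![0, 2, 1, 4, 3], ![1, 0, 4, 3, 2], ![2, 3, 0, 1, 4], ![3, 4, 2, 0, 1], ![4, 1, 3, 2, 0]],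
    ![![0, 1, 2, 3, 4], ![1, 4, 3, 0, 2], ![4, 2, 0, 1, 3], ![2, 3, 1, 4, 0], ![3, 0, 4, 2, 1], ![0, 3, 4, 1, 2], ![1, 0, 2, 4, 3], ![2, 4, 0, 3, 1], ![3, 2, 1, 0, 4], ![4, 1, 3, 2, 0]]]

/-- The rows of `dihTab` are injective maps. [folklore] -/
theorem dihTab_injective : ∀ (j : Fin 6) (t : Fin 10), Function.Injective (dihTab j t) := by
  unfold dihTab
  decide +kernel

/-- Row `0` is the identity, rows are pairwise distinct within each group. [folklore] -/
theorem dihTab_facts : (∀ j : Fin 6, dihTab j 0 = id) ∧ ∀ (j : Fin 6) (t t' : Fin 10), dihTab j t = dihTab j t' → t = t' := by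
  unfold dihTab
  refine ⟨by decide +kernel, by decide +kernel⟩

/-- The rows of `dihTab` as permutations of `Fin 5`. [folklore] -/
noncomputable def dihPerm (j : Fin 6) (t : Fin 10) : Equiv.Perm (Fin 5) :=
  Equiv.ofBijective (dihTab j t) (Finite.injective_iff_bijective.1 (dihTab_injective j t))

/-- `dihPerm j t a = dihTab j t a`. [folklore] -/
theorem dihPerm_apply (j : Fin 6) (t : Fin 10) (a : Fin 5) : dihPerm j t a = dihTab j t a := rfl

/-- **The dihedral group `D₅(j)`** as a finset of permutations of the five pairs. [folklore] -/
noncomputable def dihedralPerms (j : Fin 6) : Finset (Equiv.Perm (Fin 5)) := univ.image (dihPerm j)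

/-- Membership in `dihedralPerms j`. [folklore] -/
theorem mem_dihedralPerms {j : Fin 6} {π : Equiv.Perm (Fin 5)} : π ∈ dihedralPerms j ↔ ∃ t : Fin 10, dihPerm j t = π := by
  simp [dihedralPerms]

/-- The rows are members. [folklore] -/
theorem dihPerm_mem (j : Fin 6) (t : Fin 10) : dihPerm j t ∈ dihedralPerms j := mem_dihedralPerms.2 ⟨t, rfl⟩

/-- **Words**: for every rotation power `ρ_j^{a+1}` (`a < 4`) and every reflection `r = dihPerm j (5+b)` of `D₅(j)`, each
element of `D₅(j)` is `(ρ_j^{a+1})^i · r^u` (`i < 5`, `u < 2`). [folklore] -/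
theorem dihPerm_eq_word : ∀ (j : Fin 6) (a : Fin 4) (b : Fin 5) (t : Fin 10), ∃ (i : Fin 5) (u : Fin 2),
    dihPerm j t = (dihPerm j 1 ^ ((a : ℕ) + 1)) ^ (i : ℕ) * dihPerm j (Fin.natAdd 5 b) ^ (u : ℕ) := by
  decide +kernel

/-- **Every labelling of the standard rotation–reflection pair lands in the table**: for every permutation `g` of the pairs,
`g ρ₀ g⁻¹` is a nontrivial rotation power and `g r₀ g⁻¹` a reflection of one `D₅(j)` (`ρ₀ = dihPerm 0 1 : x ↦ x + 1`,
`r₀ = dihPerm 0 5 : x ↦ −x`; i.e. `g D₅(0) g⁻¹ = D₅(j)`). [folklore] -/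
theorem exists_dihedral_conj : ∀ g : Equiv.Perm (Fin 5), ∃ j : Fin 6,
    (∃ a : Fin 4, g * dihPerm 0 1 * g⁻¹ = dihPerm j 1 ^ ((a : ℕ) + 1)) ∧
      ∃ b : Fin 5, g * dihPerm 0 5 * g⁻¹ = dihPerm j (Fin.natAdd 5 b) := by
  decide +kernel

/-- **The clean cases**: all six `j` for meeting types (`c = true`); `j ∉ {1, 2}` for disjoint types (`c = false`). [folklore] -/
def dihGood (c : Bool) (j : Fin 6) : Bool := c || (decide (j ≠ 1) && decide (j ≠ 2))

/-! ## §2 The defect law, case by case -/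

/-- The defect law from the ten rows of `dihTab 0` at the positions `c = true` (linear algebra). [folklore] -/
private theorem defect_dih_T0 (e : ℤ) (d : Fin 2 → Fin 5 → ℤ)
    (h : ∀ t : Fin 10, e + ∑ m : Fin 2, ∑ a : Fin 5, (if inPos true m (dihTab 0 t a) then d m a else -d m a) = 0) :
    (∀ (m : Fin 2) (a : Fin 5), d m a = d m 0) ∧ e = d 0 0 + d 1 0 := by
  have h0 := h 0; have h1 := h 1; have h2 := h 2; have h3 := h 3; have h4 := h 4
  have h5 := h 5; have h6 := h 6; have h7 := h 7; have h8 := h 8; have h9 := h 9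
  simp [Fin.sum_univ_two, Fin.sum_univ_five, inPos, dihTab] at h0 h1 h2 h3 h4 h5 h6 h7 h8 h9
  have e01 : d 0 1 = d 0 0 := by linarith
  have e02 : d 0 2 = d 0 0 := by linarith
  have e03 : d 0 3 = d 0 0 := by linarith
  have e04 : d 0 4 = d 0 0 := by linarith
  have e11 : d 1 1 = d 1 0 := by linarith
  have e12 : d 1 2 = d 1 0 := by linarith
  have e13 : d 1 3 = d 1 0 := by linarith
  have e14 : d 1 4 = d 1 0 := by linarith
  refine ⟨fun m a => ?_, by linarith⟩
  fin_cases m <;> fin_cases a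
  exacts [rfl, e01, e02, e03, e04, rfl, e11, e12, e13, e14]

/-- The defect law from the ten rows of `dihTab 1` at the positions `c = true` (linear algebra). [folklore] -/
private theorem defect_dih_T1 (e : ℤ) (d : Fin 2 → Fin 5 → ℤ)
    (h : ∀ t : Fin 10, e + ∑ m : Fin 2, ∑ a : Fin 5, (if inPos true m (dihTab 1 t a) then d m a else -d m a) = 0) :
    (∀ (m : Fin 2) (a : Fin 5), d m a = d m 0) ∧ e = d 0 0 + d 1 0 := by
  have h0 := h 0; have h1 := h 1; have h2 := h 2; have h3 := h 3; have h4 := h 4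
  have h5 := h 5; have h6 := h 6; have h7 := h 7; have h8 := h 8; have h9 := h 9
  simp [Fin.sum_univ_two, Fin.sum_univ_five, inPos, dihTab] at h0 h1 h2 h3 h4 h5 h6 h7 h8 h9
  have e01 : d 0 1 = d 0 0 := by linarith
  have e02 : d 0 2 = d 0 0 := by linarith
  have e03 : d 0 3 = d 0 0 := by linarith
  have e04 : d 0 4 = d 0 0 := by linarith
  have e11 : d 1 1 = d 1 0 := by linarith
  have e12 : d 1 2 = d 1 0 := by linarith
  have e13 : d 1 3 = d 1 0 := by linarith
  have e14 : d 1 4 = d 1 0 := by linarith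
  refine ⟨fun m a => ?_, by linarith⟩
  fin_cases m <;> fin_cases a
  exacts [rfl, e01, e02, e03, e04, rfl, e11, e12, e13, e14]

/-- The defect law from the ten rows of `dihTab 2` at the positions `c = true` (linear algebra). [folklore] -/
private theorem defect_dih_T2 (e : ℤ) (d : Fin 2 → Fin 5 → ℤ)
    (h : ∀ t : Fin 10, e + ∑ m : Fin 2, ∑ a : Fin 5, (if inPos true m (dihTab 2 t a) then d m a else -d m a) = 0) :
    (∀ (m : Fin 2) (a : Fin 5), d m a = d m 0) ∧ e = d 0 0 + d 1 0 := by
  have h0 := h 0; have h1 := h 1; have h2 := h 2; have h3 := h 3; have h4 := h 4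
  have h5 := h 5; have h6 := h 6; have h7 := h 7; have h8 := h 8; have h9 := h 9
  simp [Fin.sum_univ_two, Fin.sum_univ_five, inPos, dihTab] at h0 h1 h2 h3 h4 h5 h6 h7 h8 h9
  have e01 : d 0 1 = d 0 0 := by linarith
  have e02 : d 0 2 = d 0 0 := by linarith
  have e03 : d 0 3 = d 0 0 := by linarith
  have e04 : d 0 4 = d 0 0 := by linarith
  have e11 : d 1 1 = d 1 0 := by linarith
  have e12 : d 1 2 = d 1 0 := by linarith
  have e13 : d 1 3 = d 1 0 := by linarith
  have e14 : d 1 4 = d 1 0 := by linarith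
  refine ⟨fun m a => ?_, by linarith⟩
  fin_cases m <;> fin_cases a
  exacts [rfl, e01, e02, e03, e04, rfl, e11, e12, e13, e14]

/-- The defect law from the ten rows of `dihTab 3` at the positions `c = true` (linear algebra). [folklore] -/
private theorem defect_dih_T3 (e : ℤ) (d : Fin 2 → Fin 5 → ℤ)
    (h : ∀ t : Fin 10, e + ∑ m : Fin 2, ∑ a : Fin 5, (if inPos true m (dihTab 3 t a) then d m a else -d m a) = 0) :
    (∀ (m : Fin 2) (a : Fin 5), d m a = d m 0) ∧ e = d 0 0 + d 1 0 := by
  have h0 := h 0; have h1 := h 1; have h2 := h 2; have h3 := h 3; have h4 := h 4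
  have h5 := h 5; have h6 := h 6; have h7 := h 7; have h8 := h 8; have h9 := h 9
  simp [Fin.sum_univ_two, Fin.sum_univ_five, inPos, dihTab] at h0 h1 h2 h3 h4 h5 h6 h7 h8 h9
  have e01 : d 0 1 = d 0 0 := by linarith
  have e02 : d 0 2 = d 0 0 := by linarith
  have e03 : d 0 3 = d 0 0 := by linarith
  have e04 : d 0 4 = d 0 0 := by linarith
  have e11 : d 1 1 = d 1 0 := by linarith
  have e12 : d 1 2 = d 1 0 := by linarith
  have e13 : d 1 3 = d 1 0 := by linarith
  have e14 : d 1 4 = d 1 0 := by linarith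
  refine ⟨fun m a => ?_, by linarith⟩
  fin_cases m <;> fin_cases a
  exacts [rfl, e01, e02, e03, e04, rfl, e11, e12, e13, e14]

/-- The defect law from the ten rows of `dihTab 4` at the positions `c = true` (linear algebra). [folklore] -/
private theorem defect_dih_T4 (e : ℤ) (d : Fin 2 → Fin 5 → ℤ)
    (h : ∀ t : Fin 10, e + ∑ m : Fin 2, ∑ a : Fin 5, (if inPos true m (dihTab 4 t a) then d m a else -d m a) = 0) :
    (∀ (m : Fin 2) (a : Fin 5), d m a = d m 0) ∧ e = d 0 0 + d 1 0 := by
  have h0 := h 0; have h1 := h 1; have h2 := h 2; have h3 := h 3; have h4 := h 4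
  have h5 := h 5; have h6 := h 6; have h7 := h 7; have h8 := h 8; have h9 := h 9
  simp [Fin.sum_univ_two, Fin.sum_univ_five, inPos, dihTab] at h0 h1 h2 h3 h4 h5 h6 h7 h8 h9
  have e01 : d 0 1 = d 0 0 := by linarith
  have e02 : d 0 2 = d 0 0 := by linarith
  have e03 : d 0 3 = d 0 0 := by linarith
  have e04 : d 0 4 = d 0 0 := by linarith
  have e11 : d 1 1 = d 1 0 := by linarith
  have e12 : d 1 2 = d 1 0 := by linarith
  have e13 : d 1 3 = d 1 0 := by linarith
  have e14 : d 1 4 = d 1 0 := by linarith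
  refine ⟨fun m a => ?_, by linarith⟩
  fin_cases m <;> fin_cases a
  exacts [rfl, e01, e02, e03, e04, rfl, e11, e12, e13, e14]

/-- The defect law from the ten rows of `dihTab 5` at the positions `c = true` (linear algebra). [folklore] -/
private theorem defect_dih_T5 (e : ℤ) (d : Fin 2 → Fin 5 → ℤ)
    (h : ∀ t : Fin 10, e + ∑ m : Fin 2, ∑ a : Fin 5, (if inPos true m (dihTab 5 t a) then d m a else -d m a) = 0) :
    (∀ (m : Fin 2) (a : Fin 5), d m a = d m 0) ∧ e = d 0 0 + d 1 0 := by
  have h0 := h 0; have h1 := h 1; have h2 := h 2; have h3 := h 3; have h4 := h 4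
  have h5 := h 5; have h6 := h 6; have h7 := h 7; have h8 := h 8; have h9 := h 9
  simp [Fin.sum_univ_two, Fin.sum_univ_five, inPos, dihTab] at h0 h1 h2 h3 h4 h5 h6 h7 h8 h9
  have e01 : d 0 1 = d 0 0 := by linarith
  have e02 : d 0 2 = d 0 0 := by linarith
  have e03 : d 0 3 = d 0 0 := by linarith
  have e04 : d 0 4 = d 0 0 := by linarith
  have e11 : d 1 1 = d 1 0 := by linarith
  have e12 : d 1 2 = d 1 0 := by linarith
  have e13 : d 1 3 = d 1 0 := by linarith
  have e14 : d 1 4 = d 1 0 := by linarith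
  refine ⟨fun m a => ?_, by linarith⟩
  fin_cases m <;> fin_cases a
  exacts [rfl, e01, e02, e03, e04, rfl, e11, e12, e13, e14]

/-- The defect law from the ten rows of `dihTab 0` at the positions `c = false` (linear algebra). [folklore] -/
private theorem defect_dih_F0 (e : ℤ) (d : Fin 2 → Fin 5 → ℤ)
    (h : ∀ t : Fin 10, e + ∑ m : Fin 2, ∑ a : Fin 5, (if inPos false m (dihTab 0 t a) then d m a else -d m a) = 0) :
    (∀ (m : Fin 2) (a : Fin 5), d m a = d m 0) ∧ e = d 0 0 + d 1 0 := by
  have h0 := h 0; have h1 := h 1; have h2 := h 2; have h3 := h 3; have h4 := h 4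
  have h5 := h 5; have h6 := h 6; have h7 := h 7; have h8 := h 8; have h9 := h 9
  simp [Fin.sum_univ_two, Fin.sum_univ_five, inPos, dihTab] at h0 h1 h2 h3 h4 h5 h6 h7 h8 h9
  have e01 : d 0 1 = d 0 0 := by linarith
  have e02 : d 0 2 = d 0 0 := by linarith
  have e03 : d 0 3 = d 0 0 := by linarith
  have e04 : d 0 4 = d 0 0 := by linarith
  have e11 : d 1 1 = d 1 0 := by linarith
  have e12 : d 1 2 = d 1 0 := by linarith
  have e13 : d 1 3 = d 1 0 := by linarith
  have e14 : d 1 4 = d 1 0 := by linarith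
  refine ⟨fun m a => ?_, by linarith⟩
  fin_cases m <;> fin_cases a
  exacts [rfl, e01, e02, e03, e04, rfl, e11, e12, e13, e14]

/-- The defect law from the ten rows of `dihTab 3` at the positions `c = false` (linear algebra). [folklore] -/
private theorem defect_dih_F3 (e : ℤ) (d : Fin 2 → Fin 5 → ℤ)
    (h : ∀ t : Fin 10, e + ∑ m : Fin 2, ∑ a : Fin 5, (if inPos false m (dihTab 3 t a) then d m a else -d m a) = 0) :
    (∀ (m : Fin 2) (a : Fin 5), d m a = d m 0) ∧ e = d 0 0 + d 1 0 := by
  have h0 := h 0; have h1 := h 1; have h2 := h 2; have h3 := h 3; have h4 := h 4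
  have h5 := h 5; have h6 := h 6; have h7 := h 7; have h8 := h 8; have h9 := h 9
  simp [Fin.sum_univ_two, Fin.sum_univ_five, inPos, dihTab] at h0 h1 h2 h3 h4 h5 h6 h7 h8 h9
  have e01 : d 0 1 = d 0 0 := by linarith
  have e02 : d 0 2 = d 0 0 := by linarith
  have e03 : d 0 3 = d 0 0 := by linarith
  have e04 : d 0 4 = d 0 0 := by linarith
  have e11 : d 1 1 = d 1 0 := by linarith
  have e12 : d 1 2 = d 1 0 := by linarith
  have e13 : d 1 3 = d 1 0 := by linarith
  have e14 : d 1 4 = d 1 0 := by linarith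
  refine ⟨fun m a => ?_, by linarith⟩
  fin_cases m <;> fin_cases a
  exacts [rfl, e01, e02, e03, e04, rfl, e11, e12, e13, e14]

/-- The defect law from the ten rows of `dihTab 4` at the positions `c = false` (linear algebra). [folklore] -/
private theorem defect_dih_F4 (e : ℤ) (d : Fin 2 → Fin 5 → ℤ)
    (h : ∀ t : Fin 10, e + ∑ m : Fin 2, ∑ a : Fin 5, (if inPos false m (dihTab 4 t a) then d m a else -d m a) = 0) :
    (∀ (m : Fin 2) (a : Fin 5), d m a = d m 0) ∧ e = d 0 0 + d 1 0 := by
  have h0 := h 0; have h1 := h 1; have h2 := h 2; have h3 := h 3; have h4 := h 4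
  have h5 := h 5; have h6 := h 6; have h7 := h 7; have h8 := h 8; have h9 := h 9
  simp [Fin.sum_univ_two, Fin.sum_univ_five, inPos, dihTab] at h0 h1 h2 h3 h4 h5 h6 h7 h8 h9
  have e01 : d 0 1 = d 0 0 := by linarith
  have e02 : d 0 2 = d 0 0 := by linarith
  have e03 : d 0 3 = d 0 0 := by linarith
  have e04 : d 0 4 = d 0 0 := by linarith
  have e11 : d 1 1 = d 1 0 := by linarith
  have e12 : d 1 2 = d 1 0 := by linarith
  have e13 : d 1 3 = d 1 0 := by linarith
  have e14 : d 1 4 = d 1 0 := by linarith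
  refine ⟨fun m a => ?_, by linarith⟩
  fin_cases m <;> fin_cases a
  exacts [rfl, e01, e02, e03, e04, rfl, e11, e12, e13, e14]

/-- The defect law from the ten rows of `dihTab 5` at the positions `c = false` (linear algebra). [folklore] -/
private theorem defect_dih_F5 (e : ℤ) (d : Fin 2 → Fin 5 → ℤ)
    (h : ∀ t : Fin 10, e + ∑ m : Fin 2, ∑ a : Fin 5, (if inPos false m (dihTab 5 t a) then d m a else -d m a) = 0) :
    (∀ (m : Fin 2) (a : Fin 5), d m a = d m 0) ∧ e = d 0 0 + d 1 0 := by
  have h0 := h 0; have h1 := h 1; have h2 := h 2; have h3 := h 3; have h4 := h 4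
  have h5 := h 5; have h6 := h 6; have h7 := h 7; have h8 := h 8; have h9 := h 9
  simp [Fin.sum_univ_two, Fin.sum_univ_five, inPos, dihTab] at h0 h1 h2 h3 h4 h5 h6 h7 h8 h9
  have e01 : d 0 1 = d 0 0 := by linarith
  have e02 : d 0 2 = d 0 0 := by linarith
  have e03 : d 0 3 = d 0 0 := by linarith
  have e04 : d 0 4 = d 0 0 := by linarith
  have e11 : d 1 1 = d 1 0 := by linarith
  have e12 : d 1 2 = d 1 0 := by linarith
  have e13 : d 1 3 = d 1 0 := by linarith
  have e14 : d 1 4 = d 1 0 := by linarith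
  refine ⟨fun m a => ?_, by linarith⟩
  fin_cases m <;> fin_cases a
  exacts [rfl, e01, e02, e03, e04, rfl, e11, e12, e13, e14]

/-- **THE DEFECT LAW UNDER A DIHEDRAL GROUP.**  For the ten clean cases `dihGood c j` the signed equations
`e + Σ_{m,a} ± d_{m,a} = 0` (sign `+` iff `π a ∈ I_m`) at the ten elements of `D₅(j)` force `d_{m,a} = d_{m,0}` for all `m, a` AND
`e = d_{0,0} + d_{1,0}`. [cite: MoonenZarhin1995Duke, Thm. 2.4] [cite: GaoUllmo2025, Thm 3.1] -/
theorem defectD_of_signed_dihedral (c : Bool) (j : Fin 6) (hg : dihGood c j = true) (e : ℤ) (d : Fin 2 → Fin 5 → ℤ)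
    (h : ∀ t : Fin 10, e + ∑ m : Fin 2, ∑ a : Fin 5, (if inPos c m (dihTab j t a) then d m a else -d m a) = 0) :
    (∀ (m : Fin 2) (a : Fin 5), d m a = d m 0) ∧ e = d 0 0 + d 1 0 := by
  fin_cases j <;> cases c
  · exact defect_dih_F0 e d h
  · exact defect_dih_T0 e d h
  · exact absurd hg (by decide)
  · exact defect_dih_T1 e d h
  · exact absurd hg (by decide)
  · exact defect_dih_T2 e d h
  · exact defect_dih_F3 e d h
  · exact defect_dih_T3 e d h
  · exact defect_dih_F4 e d h
  · exact defect_dih_T4 e d h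
  · exact defect_dih_F5 e d h
  · exact defect_dih_T5 e d h

/-! ## §3 `D₅(j)`-balanced configurations are `A₅`-balanced -/

variable {α : Type*} {c : Bool} {j : Fin 6} {v : α → PtD}

/-- **`D₅(j)`-BALANCED ⟹ `A₅`-BALANCED** (clean cases): a configuration balanced under the ten permutations of `D₅(j)`
(`ModelBalancedP c (dihedralPerms j) v T`) satisfies all sixty equations `ModelBalancedD` of `Census/DecicWeil23Pair` — so gen
22's parts / extraction / induction and the CorCM chain apply verbatim. [cite: MoonenZarhin1995Duke, Thm. 2.4] [cite: GaoUllmo2025, Thm 3.1] -/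
theorem modelBalancedD_of_modelBalancedP_dihedral (hg : dihGood c j = true) {T : Finset α}
    (hT : ModelBalancedP c (dihedralPerms j) v T) : ModelBalancedD c v T := by
  have hs : ∀ t : Fin 10, (((T.filter fun x => v x = Sum.inl true).card : ℤ) - (T.filter fun x => v x = Sum.inl false).card) +
      ∑ m : Fin 2, ∑ a : Fin 5, (if inPos c m (dihTab j t a) then
        (((T.filter fun x => v x = Sum.inr (m, (a, true))).card : ℤ) - (T.filter fun x => v x = Sum.inr (m, (a, false))).card)
        else -((((T.filter fun x => v x = Sum.inr (m, (a, true))).card : ℤ) -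
          (T.filter fun x => v x = Sum.inr (m, (a, false))).card))) = 0 :=
    fun t => (balancedP_iff_signed c (dihPerm j t) (fun y => (T.filter fun x => v x = y).card)).1 (by
      have h := hT (dihPerm j t) (dihPerm_mem j t)
      rw [card_filter_mem_eq_sumD, card_eq_sumD v T] at h
      exact h)
  obtain ⟨hd, he⟩ := defectD_of_signed_dihedral c j hg _
    (fun m a => (((T.filter fun x => v x = Sum.inr (m, (a, true))).card : ℕ) : ℤ) -
      (T.filter fun x => v x = Sum.inr (m, (a, false))).card) hs
  intro r
  rw [card_filter_mem_eq_sumD, card_eq_sumD v T, balancedD_iff_signed]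
  exact signed_of_defectD c (Equiv.ofBijective (permD r) (Finite.injective_iff_bijective.1 (permD_facts.1 r))) hd he

end Summit.HodgeConjecture.CorCM.Census.DecicWeil23Pair
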